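/-
VALUE = THEOREM, NOT summit progress (cell b2b-lgcu-borel, gen 21); crux 14079 untouched.
-/
import Mathlib
import Summits.MatrixMultiplication.MatrixMultiplication.Theorems.SubgroupIdentityDesigns.Negative.RootChain
import Summits.MatrixMultiplication.MatrixMultiplication.Theorems.SubgroupIdentityDesigns.Negative.DesignConjGL

/-!
# Root chains in every frame (conjugated `U₃`-certificates)

VALUE = THEOREM (every `p`, every `m ≥ 3`, every `ε`), NOT summit progress.

`RootChain.lean` excludes a level-one identity design when the three STANDARD root groups
`X_{ij}, X_{ik}, X_{jk}` (or, generally, `U ∖ 1` for the standard unitriangular `U ≅ U₃(𝔽_p)`)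
are covered by the triple products `H₁ H₂ H₃`.  `DesignConjGL.lean` transports level-one designs
along simultaneous conjugation.  Together: for EVERY `x ∈ GL_m(𝔽_p)`, if `x (U ∖ 1) x⁻¹ ⊆ H₁ H₂ H₃`
(`no_design_of_cover_conj`) — in particular if the conjugated root groups `x X_{ij} x⁻¹`,
`x X_{ik} x⁻¹`, `x X_{jk} x⁻¹` sit one per member (`no_design_of_rootChain_conj₁₂₃/₃₂₁/₁₃₂`) — then
`(H₁, H₂, H₃)` carries no level-one identity design.  No TPP, no volume hypothesis.

Since `GL_m(𝔽_p)` is transitive on unitriangular frames, this is the intrinsic statement: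
transvections `t_a ∈ H_a, t_b ∈ H_b, t_c ∈ H_c` (`{a,b,c} = {1,2,3}`) with
`centre t_a = centre t_b`, `axis t_b = axis t_c`, `centre t_c ∉ axis t_a` (they generate the three
root groups of one `U₃`; `p` prime, so a root group is generated by any of its transvections)
exclude a level-one design.  (The frame-transitivity itself is linear algebra not repeated here:
the theorems take the conjugator `x` as a hypothesis.)

HONEST SCOPE.  Configuration exclusion; no `(p,m,ε)` cell is emptied.
-/

set_option linter.dupNamespace false

noncomputable section

open scoped BigOperators Matrix Classical
open Summit.MatrixMultiplication.MatrixMultiplication.Theorems.LieRankDesigns.Negative (GLm Mat)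

namespace Summit.MatrixMultiplication.MatrixMultiplication.Theorems.SubgroupIdentityDesigns.Negative
namespace RootChainFrames

open RootChain (U uGL no_design_of_cover no_design_of_rootChain₁₂₃ no_design_of_rootChain₃₂₁
  no_design_of_rootChain₁₃₂)
open DesignConjGL (design_conj)

variable {p m : ℕ}

/-- `x g x⁻¹ ∈ H` gives `g ∈ x⁻¹ H x = H.map (conj x⁻¹)`. -/
theorem mem_map_conj_inv {H : Subgroup (GLm p m)} {x g : GLm p m} (h : x * g * x⁻¹ ∈ H) :
    g ∈ H.map (MulAut.conj x⁻¹).toMonoidHom :=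
  Subgroup.mem_map.mpr ⟨x * g * x⁻¹, h, by
    simp only [MulEquiv.coe_toMonoidHom, MulAut.conj_apply, inv_inv]; group⟩

variable [hp : Fact p.Prime] {i j k : Fin m} (hij : i ≠ j) (hik : i ≠ k) (hjk : j ≠ k)
  {H₁ H₂ H₃ : Subgroup (GLm p m)}
include hij hik hjk

/-- **CONJUGATED `U`-CERTIFICATE.**  If `x (U ∖ 1) x⁻¹ ⊆ H₁ H₂ H₃` for some `x`, then
`(H₁, H₂, H₃)` carries no level-one identity design. -/
theorem no_design_of_cover_conj (x : GLm p m)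
    (hcov : ∀ g ∈ U (p := p) hij hik hjk, g ≠ 1 →
      ∃ a ∈ H₁, ∃ b ∈ H₂, ∃ c ∈ H₃, a * b * c = x * g * x⁻¹) :
    ¬ ∃ c : Mat p m → ℂ, (∀ M, 1 < M.rank → c M = 0) ∧
      (∑ M, c M * ZMod.stdAddChar (Matrix.trace (M * ((1 : GLm p m) : Mat p m)))) = 1 ∧
      ∀ a ∈ H₁, ∀ b ∈ H₂, ∀ g ∈ H₃, a * b * g ≠ 1 →
        (∑ M, c M * ZMod.stdAddChar (Matrix.trace (M * ((a * b * g : GLm p m) : Mat p m)))) = 0 := by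
  intro hdes
  refine no_design_of_cover hij hik hjk (H₁ := H₁.map (MulAut.conj x⁻¹).toMonoidHom)
    (H₂ := H₂.map (MulAut.conj x⁻¹).toMonoidHom) (H₃ := H₃.map (MulAut.conj x⁻¹).toMonoidHom)
    ?_ (design_conj 1 H₁ H₂ H₃ x⁻¹ hdes)
  intro g hg hne
  obtain ⟨a, ha, b, hb, c, hc, habc⟩ := hcov g hg hne
  refine ⟨x⁻¹ * a * x, mem_map_conj_inv (by simpa [mul_assoc] using ha), x⁻¹ * b * x,
    mem_map_conj_inv (by simpa [mul_assoc] using hb), x⁻¹ * c * x,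
    mem_map_conj_inv (by simpa [mul_assoc] using hc), ?_⟩
  calc x⁻¹ * a * x * (x⁻¹ * b * x) * (x⁻¹ * c * x) = x⁻¹ * (a * b * c) * x := by group
    _ = g := by rw [habc]; group

/-- **ROOT CHAIN IN A FRAME**: `x X_{ij} x⁻¹ ≤ H₁`, `x X_{ik} x⁻¹ ≤ H₂`, `x X_{jk} x⁻¹ ≤ H₃`
exclude a level-one identity design. -/
theorem no_design_of_rootChain_conj₁₂₃ (x : GLm p m)
    (h₁ : ∀ t, x * uGL hij hik hjk t 0 0 * x⁻¹ ∈ H₁)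
    (h₂ : ∀ t, x * uGL hij hik hjk 0 t 0 * x⁻¹ ∈ H₂)
    (h₃ : ∀ t, x * uGL hij hik hjk 0 0 t * x⁻¹ ∈ H₃) :
    ¬ ∃ c : Mat p m → ℂ, (∀ M, 1 < M.rank → c M = 0) ∧
      (∑ M, c M * ZMod.stdAddChar (Matrix.trace (M * ((1 : GLm p m) : Mat p m)))) = 1 ∧
      ∀ a ∈ H₁, ∀ b ∈ H₂, ∀ g ∈ H₃, a * b * g ≠ 1 →
        (∑ M, c M * ZMod.stdAddChar (Matrix.trace (M * ((a * b * g : GLm p m) : Mat p m)))) = 0 :=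
  fun hdes => no_design_of_rootChain₁₂₃ hij hik hjk (fun t => mem_map_conj_inv (h₁ t))
    (fun t => mem_map_conj_inv (h₂ t)) (fun t => mem_map_conj_inv (h₃ t))
    (design_conj 1 H₁ H₂ H₃ x⁻¹ hdes)

/-- **ROOT CHAIN IN A FRAME, reversed**: `x X_{jk} x⁻¹ ≤ H₁`, `x X_{ik} x⁻¹ ≤ H₂`,
`x X_{ij} x⁻¹ ≤ H₃`. -/
theorem no_design_of_rootChain_conj₃₂₁ (x : GLm p m)
    (h₁ : ∀ t, x * uGL hij hik hjk 0 0 t * x⁻¹ ∈ H₁)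
    (h₂ : ∀ t, x * uGL hij hik hjk 0 t 0 * x⁻¹ ∈ H₂)
    (h₃ : ∀ t, x * uGL hij hik hjk t 0 0 * x⁻¹ ∈ H₃) :
    ¬ ∃ c : Mat p m → ℂ, (∀ M, 1 < M.rank → c M = 0) ∧
      (∑ M, c M * ZMod.stdAddChar (Matrix.trace (M * ((1 : GLm p m) : Mat p m)))) = 1 ∧
      ∀ a ∈ H₁, ∀ b ∈ H₂, ∀ g ∈ H₃, a * b * g ≠ 1 →
        (∑ M, c M * ZMod.stdAddChar (Matrix.trace (M * ((a * b * g : GLm p m) : Mat p m)))) = 0 :=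
  fun hdes => no_design_of_rootChain₃₂₁ hij hik hjk (fun t => mem_map_conj_inv (h₁ t))
    (fun t => mem_map_conj_inv (h₂ t)) (fun t => mem_map_conj_inv (h₃ t))
    (design_conj 1 H₁ H₂ H₃ x⁻¹ hdes)

/-- **ROOT CHAIN IN A FRAME, mixed**: `x X_{ij} x⁻¹ ≤ H₁`, `x X_{jk} x⁻¹ ≤ H₂`,
`x X_{ik} x⁻¹ ≤ H₃`. -/
theorem no_design_of_rootChain_conj₁₃₂ (x : GLm p m)
    (h₁ : ∀ t, x * uGL hij hik hjk t 0 0 * x⁻¹ ∈ H₁)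
    (h₂ : ∀ t, x * uGL hij hik hjk 0 0 t * x⁻¹ ∈ H₂)
    (h₃ : ∀ t, x * uGL hij hik hjk 0 t 0 * x⁻¹ ∈ H₃) :
    ¬ ∃ c : Mat p m → ℂ, (∀ M, 1 < M.rank → c M = 0) ∧
      (∑ M, c M * ZMod.stdAddChar (Matrix.trace (M * ((1 : GLm p m) : Mat p m)))) = 1 ∧
      ∀ a ∈ H₁, ∀ b ∈ H₂, ∀ g ∈ H₃, a * b * g ≠ 1 →
        (∑ M, c M * ZMod.stdAddChar (Matrix.trace (M * ((a * b * g : GLm p m) : Mat p m)))) = 0 :=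
  fun hdes => no_design_of_rootChain₁₃₂ hij hik hjk (fun t => mem_map_conj_inv (h₁ t))
    (fun t => mem_map_conj_inv (h₂ t)) (fun t => mem_map_conj_inv (h₃ t))
    (design_conj 1 H₁ H₂ H₃ x⁻¹ hdes)

end RootChainFrames
end Summit.MatrixMultiplication.MatrixMultiplication.Theorems.SubgroupIdentityDesigns.Negative
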